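/-
Origin: expansion seat `planner-pub-hodgecm-landherr-g8-0`, handover #2 2026-08-18T07:26:44Z (`HOME/pub-hodgecm-landherr-g8/lean/LandherrG8/HermSpace3Similitude.lean`, md5 bfec5857, 289 lines);
landed by the gen-7 packager in gate run 26 as `HodgeCM/Proofs/LandherrSimilitude.lean` (import ^import LandherrG8\.HermSpace3Classification\b→import HodgeCM.Proofs.LandherrHermSpace3 ×1).
-/
/-
Copyright: pub-hodgecm formalisation cell (harness21, 2026). New file (not vendored).
Origin: HOME/pub-hodgecm-landherr-g8/lean/LandherrG8/HermSpace3Similitude.lean — session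
planner-pub-hodgecm-landherr-g8-0 (unit pub-hodgecm-landherr-g8, EXPANSION part (c) `Lemma33bLandherr`, gen 8).
Intended final place: `HodgeCM/Proofs/LandherrSimilitude.lean` (additive leaf; imports only
`HodgeCM.Proofs.LandherrHermSpace3` (run 25); nothing in the package depends on it).
-/
import Summits.HodgeConjecture.HodgeCM.Proofs.LandherrHermSpace3

set_option autoImplicit false

/-!
# PerL's hermitian 3-spaces are all similar; their unitary groups are conjugate in `GL₃(L)`

`HodgeCM.HermSpace3.classification` (`Proofs/LandherrHermSpace3.lean`) classifies the hermitian 3-spaces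
`(V₃,h)` of PerL's signature — `(2,1)` at the place of `ι₁`, `(3,0)` at every other real place of `L₀` — up to
ISOMETRY by the class of the discriminant `det h` in `L₀^× / N_{L/L₀}(L^×)`; there are in general many classes.
This file records the consequence that matters for the GROUPS in PerL Thm 4.4 ("`Γ ⊂ U(V₃,h)(L₀)` a torsion-free
congruence subgroup, `(V₃,h)` any"):

* §1 rescaling `h ↦ a·h` by a scalar `a ∈ L₀^×` that is positive at every real place (`HermSpace3.IsTotPos`)
  preserves PerL's signature conditions (`HermSpace3.smulPos`), multiplies the discriminant by `a³ ≡ a`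
  (`det_smulPos`; `a² = a·σ(a)` is a norm), and does not change the unitary group at all
  (`unitaryGroup_smul`: `U(a·h) = U(h)` as subgroups of `GL₃(L)`);
* §2 **similarity** (`HermSpace3.exists_isometric_smul`, `HermSpace3.similar`): ANY two `V V' : HermSpace3 L ι₁` become
  isometric after rescaling one of them by the totally positive scalar `a = det h / det h'` — because the dimension
  `3` is odd, `det (a·h') = a³ det h' ≡ det h` modulo norms, and Landherr's theorem (`isometric_iff_det`) applies;
* §3 hence the **unitary groups are conjugate** (`HermSpace3.unitaryGroup_conjugate`): for all `V V'` there is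
  `x ∈ GL₃(L)` with `U(V'.Hm) = x⁻¹ · U(V.Hm) · x`, i.e. `g ∈ U(h') ↔ x g x⁻¹ ∈ U(h)`, and in particular
  `U(h') ≃* U(h)` (`HermSpace3.unitaryGroupEquiv`).  So the quantifier "`(V₃,h)` any" of PerL Thm 4.4 ranges, as
  far as the ambient group `U(V₃,h)(L₀) ⊂ GL₃(L)` is concerned, over a SINGLE `GL₃(L)`-conjugacy class; what
  varies with `(V₃,h)` and the level is only the arithmetic subgroup `Γ`.

(`unitaryGroup σ H ≤ GL₃(L)` is the vendored BMM-typed unitary group of `HodgeCM/Vendored/Hermitian.lean`, the one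
used by `HodgeCM.Level`.)  Pure proof over `Proofs/LandherrHermSpace3.lean`: nothing is cited or posited; the
closure of every theorem is the standard trio.
-/

noncomputable section

open scoped Matrix ComplexOrder
open NumberField
open Literature.AlgebraicGeometry.ShimuraVarieties

namespace HodgeCM

namespace HermSpace3

variable {L : CMField} {ι₁ : L →+* ℂ}

/-! ## §0. Congruence as an action of `GL`, and the unitary group under congruence (any finite index type) -/

section Congr

variable {ι : Type} [Fintype ι]

/-- The congruence action `H ↦ ᵗ(σx) · H · x` of a matrix `x` on Gram matrices. -/
def congrAct (L : CMField) (x H : Matrix ι ι L) : Matrix ι ι L :=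
  x.transpose.map (conjRingHomK L) * H * x

/-- (Ported verbatim from the HodgeCMPerL package; no docstring in the source.) -/
theorem congrAct_one [DecidableEq ι] (H : Matrix ι ι L) : congrAct L 1 H = H := by
  simp [congrAct, Matrix.transpose_one, Matrix.map_one (conjRingHomK L) (map_zero _) (map_one _)]

/-- (Ported verbatim from the HodgeCMPerL package; no docstring in the source.) -/
theorem congrAct_mul (x y H : Matrix ι ι L) : congrAct L (x * y) H = congrAct L y (congrAct L x H) := by
  simp only [congrAct, Matrix.transpose_mul, Matrix.map_mul, Matrix.mul_assoc]

/-- (Ported verbatim from the HodgeCMPerL package; no docstring in the source.) -/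
theorem congrAct_coe_mul [DecidableEq ι] (x y : GL ι L) (H : Matrix ι ι L) :
    congrAct L ((x * y : GL ι L) : Matrix ι ι L) H = congrAct L (y : Matrix ι ι L) (congrAct L (x : Matrix ι ι L) H) := by
  rw [Units.val_mul, congrAct_mul]

/-- (Ported verbatim from the HodgeCMPerL package; no docstring in the source.) -/
theorem congrAct_smul (x : Matrix ι ι L) (a : L) (H : Matrix ι ι L) :
    congrAct L x (a • H) = a • congrAct L x H := by
  simp only [congrAct, Matrix.mul_smul, Matrix.smul_mul]

/-- Membership in the vendored unitary group, in the `ᵗ(σg) · H · g` notation of the Landherr files. -/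
theorem mem_unitaryGroup_iff_congrAct [DecidableEq ι] (H : Matrix ι ι L) (g : GL ι L) :
    g ∈ unitaryGroup (conjRingHomK L) H ↔ congrAct L (g : Matrix ι ι L) H = H := by
  rw [mem_unitaryGroup_iff, congrAct, Matrix.transpose_map]

/-- **Rescaling does not change the unitary group**: `U(a·H) = U(H)` for `a ≠ 0`. -/
theorem unitaryGroup_smul [DecidableEq ι] {a : L} (ha : a ≠ 0) (H : Matrix ι ι L) :
    unitaryGroup (conjRingHomK L) (a • H) = unitaryGroup (conjRingHomK L) H := by
  ext g
  rw [mem_unitaryGroup_iff_congrAct, mem_unitaryGroup_iff_congrAct, congrAct_smul]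
  exact (smul_right_injective (Matrix ι ι L) ha).eq_iff

/-- **Congruent Gram matrices have conjugate unitary groups**: if `H' = ᵗ(σx) · H · x` with `x ∈ GL`, then
`g ∈ U(H') ↔ x g x⁻¹ ∈ U(H)`, i.e. `U(H') = x⁻¹ · U(H) · x`. -/
theorem mem_unitaryGroup_congrAct [DecidableEq ι] (x g : GL ι L) (H : Matrix ι ι L) :
    g ∈ unitaryGroup (conjRingHomK L) (congrAct L (x : Matrix ι ι L) H) ↔
      x * g * x⁻¹ ∈ unitaryGroup (conjRingHomK L) H := by
  rw [mem_unitaryGroup_iff_congrAct, mem_unitaryGroup_iff_congrAct, ← congrAct_coe_mul]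
  constructor
  · intro h
    calc congrAct L ((x * g * x⁻¹ : GL ι L) : Matrix ι ι L) H
        = congrAct L ((x⁻¹ : GL ι L) : Matrix ι ι L) (congrAct L ((x * g : GL ι L) : Matrix ι ι L) H) :=
          congrAct_coe_mul _ _ _
      _ = congrAct L ((x⁻¹ : GL ι L) : Matrix ι ι L) (congrAct L (x : Matrix ι ι L) H) := by rw [h]
      _ = congrAct L ((x * x⁻¹ : GL ι L) : Matrix ι ι L) H := (congrAct_coe_mul _ _ _).symm
      _ = H := by rw [mul_inv_cancel, Units.val_one, congrAct_one]
  · intro h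
    calc congrAct L ((x * g : GL ι L) : Matrix ι ι L) H
        = congrAct L ((x * g * x⁻¹ * x : GL ι L) : Matrix ι ι L) H := by rw [inv_mul_cancel_right]
      _ = congrAct L (x : Matrix ι ι L) (congrAct L ((x * g * x⁻¹ : GL ι L) : Matrix ι ι L) H) :=
          congrAct_coe_mul _ _ _
      _ = congrAct L (x : Matrix ι ι L) H := by rw [h]

/-- The same, as an equality of subgroups of `GL`: `U(ᵗ(σx) H x)` is the pull-back of `U(H)` under conjugation by `x`. -/
theorem unitaryGroup_congrAct_eq_comap [DecidableEq ι] (x : GL ι L) (H : Matrix ι ι L) :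
    unitaryGroup (conjRingHomK L) (congrAct L (x : Matrix ι ι L) H) =
      (unitaryGroup (conjRingHomK L) H).comap (MulAut.conj x).toMonoidHom := by
  ext g
  rw [Subgroup.mem_comap, mem_unitaryGroup_congrAct]
  rfl

/-- The group isomorphism `U(ᵗ(σx) H x) ≃* U(H)`, `g ↦ x g x⁻¹`. -/
def unitaryGroupCongrEquiv [DecidableEq ι] (x : GL ι L) (H : Matrix ι ι L) :
    unitaryGroup (conjRingHomK L) (congrAct L (x : Matrix ι ι L) H) ≃* unitaryGroup (conjRingHomK L) H where
  toFun g := ⟨x * g * x⁻¹, (mem_unitaryGroup_congrAct x g H).mp g.2⟩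
  invFun g := ⟨x⁻¹ * g * x, (mem_unitaryGroup_congrAct x (x⁻¹ * g * x) H).mpr (by simp [mul_assoc])⟩
  left_inv g := by ext; simp [mul_assoc]
  right_inv g := by ext; simp [mul_assoc]
  map_mul' g h := by ext; simp [mul_assoc]

/-- (Ported verbatim from the HodgeCMPerL package; no docstring in the source.) -/
@[simp] theorem unitaryGroupCongrEquiv_apply [DecidableEq ι] (x : GL ι L) (H : Matrix ι ι L)
    (g : unitaryGroup (conjRingHomK L) (congrAct L (x : Matrix ι ι L) H)) :
    ((unitaryGroupCongrEquiv x H g : unitaryGroup (conjRingHomK L) H) : GL ι L) = x * g * x⁻¹ := rfl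

end Congr

/-! ## §1. Rescaling a hermitian 3-space by a totally positive scalar of `L₀` -/

/-- `a ∈ L₀ = L^σ` is **totally positive**: positive at every real place of `L₀`, i.e. `Re τ(a) > 0` at every
complex embedding `τ` of `L` (for `σ`-fixed `a`, `τ(a)` is the real number `Re τ(a)`). -/
def IsTotPos (L : CMField) (a : L) : Prop :=
  conjRingHomK L a = a ∧ ∀ τ : L →+* ℂ, 0 < (τ a).re

/-- (Ported verbatim from the HodgeCMPerL package; no docstring in the source.) -/
theorem IsTotPos.ne_zero {a : L} (ha : IsTotPos L a) : a ≠ 0 := by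
  rintro rfl
  obtain ⟨τ⟩ := (inferInstance : Nonempty (L →+* ℂ))
  have h := ha.2 τ
  simp at h

/-- `τ(a · H) = τ(a) · τ(H)`. -/
theorem map_smul_eq (a : L) (H : Matrix (Fin 3) (Fin 3) L) (τ : L →+* ℂ) :
    (a • H).map τ = τ a • H.map τ := by
  ext i j
  simp [Matrix.map_apply, smul_eq_mul]

/-- **The rescaled space `a · (V₃,h)`.**  For a totally positive `a ∈ L₀^×`, the Gram matrix `a · Hm` is again
`σ`-hermitian of signature `(2,1)` at the place of `ι₁` (Sylvester matrix `T / √(ι₁ a)`) and positive definite at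
the other places. -/
def smulPos (V : HermSpace3 L ι₁) {a : L} (ha : IsTotPos L a) : HermSpace3 L ι₁ where
  Hm := a • V.Hm
  isHermitian i j := by
    simp only [Matrix.smul_apply, smul_eq_mul, map_mul, ha.1, V.isHermitian i j]
  signature_ι₁ := by
    obtain ⟨T, hT⟩ := V.signature_ι₁
    set r : ℝ := (ι₁ a).re with hrdef
    have hr : ι₁ a = (r : ℂ) := Lemma33bLandherrProof.embedding_eq_re L ha.1 ι₁
    have hr0 : 0 < r := ha.2 ι₁
    set c : ℝ := (Real.sqrt r)⁻¹ with hc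
    have hsqrt_pos : 0 < Real.sqrt r := Real.sqrt_pos.mpr hr0
    have hc0 : c ≠ 0 := inv_ne_zero hsqrt_pos.ne'
    have hccr : (c : ℂ) * (c : ℂ) * (r : ℂ) = 1 := by
      have hsq : Real.sqrt r ^ 2 = r := Real.sq_sqrt hr0.le
      have : c * c * r = 1 := by rw [hc]; field_simp; nlinarith [hsq]
      exact_mod_cast this
    have hTdet : (T : Matrix (Fin 3) (Fin 3) ℂ).det ≠ 0 :=
      ((Matrix.isUnit_iff_isUnit_det _).mp (Units.isUnit T)).ne_zero
    have hdet : ((c : ℂ) • (T : Matrix (Fin 3) (Fin 3) ℂ)).det ≠ 0 := by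
      rw [Matrix.det_smul]
      exact mul_ne_zero (pow_ne_zero _ (by exact_mod_cast hc0)) hTdet
    refine ⟨Matrix.GeneralLinearGroup.mkOfDetNeZero _ hdet, ?_⟩
    rw [Matrix.GeneralLinearGroup.val_mkOfDetNeZero, map_smul_eq, hr]
    have hstar : star (c : ℂ) = (c : ℂ) := Complex.conj_ofReal c
    have hexp : ((c : ℂ) • (T : Matrix (Fin 3) (Fin 3) ℂ))ᴴ * ((r : ℂ) • V.Hm.map ι₁) *
        ((c : ℂ) • (T : Matrix (Fin 3) (Fin 3) ℂ)) =
        (star (c : ℂ) * (r : ℂ) * (c : ℂ)) •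
          ((T : Matrix (Fin 3) (Fin 3) ℂ)ᴴ * V.Hm.map ι₁ * (T : Matrix (Fin 3) (Fin 3) ℂ)) := by
      simp only [Matrix.conjTranspose_smul, Matrix.smul_mul, Matrix.mul_smul, smul_smul]
      congr 1
      ring
    rw [hexp, hT, hstar, show (c : ℂ) * (r : ℂ) * (c : ℂ) = 1 by
      rw [mul_right_comm]; exact hccr, one_smul]
  posDef_of_ne τ hτ := by
    set s : ℝ := (τ a).re with hsdef
    have hs : τ a = (s : ℂ) := Lemma33bLandherrProof.embedding_eq_re L ha.1 τ
    have hs0 : (0 : ℂ) < (s : ℂ) := Complex.zero_lt_real.mpr (ha.2 τ)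
    rw [map_smul_eq, hs]
    exact (V.posDef_of_ne τ hτ).smul hs0

/-- (Ported verbatim from the HodgeCMPerL package; no docstring in the source.) -/
@[simp] theorem smulPos_Hm (V : HermSpace3 L ι₁) {a : L} (ha : IsTotPos L a) : (V.smulPos ha).Hm = a • V.Hm := rfl

/-- `det (a · h) = a³ · det h`. -/
theorem det_smulPos (V : HermSpace3 L ι₁) {a : L} (ha : IsTotPos L a) :
    (V.smulPos ha).Hm.det = a ^ 3 * V.Hm.det := by
  rw [smulPos_Hm, Matrix.det_smul, Fintype.card_fin]

/-- The unitary group of the rescaled space is the same subgroup of `GL₃(L)`. -/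
theorem unitaryGroup_smulPos (V : HermSpace3 L ι₁) {a : L} (ha : IsTotPos L a) :
    unitaryGroup (conjRingHomK L) (V.smulPos ha).Hm = unitaryGroup (conjRingHomK L) V.Hm :=
  unitaryGroup_smul ha.ne_zero V.Hm

/-! ## §2. Similarity: `(V₃,h) ≅ (det h / det h') · (V₃',h')` -/

/-- The quotient of two admissible discriminants is totally positive (they have the same sign at every real place). -/
theorem AdmissibleDisc.isTotPos_div {d d' : L} (h : AdmissibleDisc L ι₁ d) (h' : AdmissibleDisc L ι₁ d') :
    IsTotPos L (d / d') := by
  refine ⟨by rw [map_div₀, h.1, h'.1], fun τ => ?_⟩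
  have e : τ d = ((τ d).re : ℂ) := Lemma33bLandherrProof.embedding_eq_re L h.1 τ
  have e' : τ d' = ((τ d').re : ℂ) := Lemma33bLandherrProof.embedding_eq_re L h'.1 τ
  have hre : (τ (d / d')).re = (τ d).re / (τ d').re := by
    rw [map_div₀, e, e', ← Complex.ofReal_div, Complex.ofReal_re]
    simp
  rw [hre, div_pos_iff]
  by_cases hτ : InfinitePlace.mk τ = InfinitePlace.mk ι₁
  · right
    have k : ∀ x : L, (τ x).re = (ι₁ x).re := fun x => by
      rw [← LandherrRankN.re_embedding_mk τ x, ← LandherrRankN.re_embedding_mk ι₁ x, hτ]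
    rw [k, k]
    exact ⟨h.2.1, h'.2.1⟩
  · left
    exact ⟨h.2.2 τ hτ, h'.2.2 τ hτ⟩

/-- `det h / det h'` is totally positive for any two of PerL's hermitian 3-spaces. -/
theorem isTotPos_det_div_det (V V' : HermSpace3 L ι₁) : IsTotPos L (V.Hm.det / V'.Hm.det) :=
  V.admissibleDisc_det.isTotPos_div V'.admissibleDisc_det

/-- **Similarity of all `(V₃,h)`.**  Any two hermitian 3-spaces `V V'` of PerL's signature over `L` are isometric after
rescaling `V'` by the totally positive scalar `a = det h / det h' ∈ L₀^×`:
`ᵗ(σg) · V.Hm · g = a · V'.Hm` for some `g ∈ GL₃(L)`.  (Landherr: `det (a · h') = a³ det h' = det h · (det h'/det h)²`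
and `(det h'/det h)² = z σ(z)` with `z = det h'/det h ∈ L₀`.) -/
theorem exists_isometric_smul (V V' : HermSpace3 L ι₁) :
    ∃ g : GL (Fin 3) L, ((g : Matrix (Fin 3) (Fin 3) L).transpose.map (conjRingHomK L)) * V.Hm *
        (g : Matrix (Fin 3) (Fin 3) L) = (V.Hm.det / V'.Hm.det) • V'.Hm := by
  have hV := V.det_ne_zero
  have hV' := V'.det_ne_zero
  have hz : V'.Hm.det / V.Hm.det ≠ 0 := div_ne_zero hV' hV
  have key : V.Hm.det = (V'.smulPos (isTotPos_det_div_det V V')).Hm.det *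
      (V'.Hm.det / V.Hm.det * conjRingHomK L (V'.Hm.det / V.Hm.det)) := by
    rw [det_smulPos, map_div₀, V.det_isReal, V'.det_isReal]
    field_simp
  simpa only [smulPos_Hm] using isometric_of_det_class V (V'.smulPos (isTotPos_det_div_det V V')) hz key

/-- **All of PerL's hermitian 3-spaces are similar**: isometric up to a totally positive rescaling. -/
theorem similar (V V' : HermSpace3 L ι₁) :
    ∃ a : L, IsTotPos L a ∧ ∃ g : GL (Fin 3) L,
      ((g : Matrix (Fin 3) (Fin 3) L).transpose.map (conjRingHomK L)) * V.Hm * (g : Matrix (Fin 3) (Fin 3) L) =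
        a • V'.Hm :=
  ⟨V.Hm.det / V'.Hm.det, isTotPos_det_div_det V V', exists_isometric_smul V V'⟩

/-! ## §3. The unitary groups of all `(V₃,h)` are conjugate in `GL₃(L)` -/

/-- **Conjugacy of the unitary groups.**  For any two hermitian 3-spaces `V V'` of PerL's signature over `L` there is
`x ∈ GL₃(L)` with `U(V'.Hm) = x⁻¹ · U(V.Hm) · x` inside `GL₃(L)`:  `g ∈ U(h') ↔ x g x⁻¹ ∈ U(h)`. -/
theorem unitaryGroup_conjugate (V V' : HermSpace3 L ι₁) :
    ∃ x : GL (Fin 3) L, ∀ g : GL (Fin 3) L,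
      g ∈ unitaryGroup (conjRingHomK L) V'.Hm ↔ x * g * x⁻¹ ∈ unitaryGroup (conjRingHomK L) V.Hm := by
  obtain ⟨x, hx⟩ := exists_isometric_smul V V'
  refine ⟨x, fun g => ?_⟩
  rw [← unitaryGroup_smul (isTotPos_det_div_det V V').ne_zero V'.Hm, ← mem_unitaryGroup_congrAct x g V.Hm]
  rw [show congrAct L (x : Matrix (Fin 3) (Fin 3) L) V.Hm = (V.Hm.det / V'.Hm.det) • V'.Hm from hx]

/-- The same as an equality of subgroups of `GL₃(L)`: `U(h')` is the pull-back of `U(h)` under conjugation by some `x`. -/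
theorem unitaryGroup_eq_comap_conj (V V' : HermSpace3 L ι₁) :
    ∃ x : GL (Fin 3) L, unitaryGroup (conjRingHomK L) V'.Hm =
      (unitaryGroup (conjRingHomK L) V.Hm).comap (MulAut.conj x).toMonoidHom := by
  obtain ⟨x, hx⟩ := unitaryGroup_conjugate V V'
  exact ⟨x, Subgroup.ext fun g => by rw [Subgroup.mem_comap]; exact hx g⟩

/-- **The unitary groups of any two of PerL's hermitian 3-spaces are isomorphic** (by an inner automorphism of `GL₃(L)`). -/
theorem nonempty_unitaryGroup_mulEquiv (V V' : HermSpace3 L ι₁) :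
    Nonempty (unitaryGroup (conjRingHomK L) V'.Hm ≃* unitaryGroup (conjRingHomK L) V.Hm) := by
  obtain ⟨x, hx⟩ := exists_isometric_smul V V'
  have e : unitaryGroup (conjRingHomK L) V'.Hm =
      unitaryGroup (conjRingHomK L) (congrAct L (x : Matrix (Fin 3) (Fin 3) L) V.Hm) := by
    rw [show congrAct L (x : Matrix (Fin 3) (Fin 3) L) V.Hm = (V.Hm.det / V'.Hm.det) • V'.Hm from hx,
      unitaryGroup_smul (isTotPos_det_div_det V V').ne_zero]
  exact ⟨(MulEquiv.subgroupCongr e).trans (unitaryGroupCongrEquiv x V.Hm)⟩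

/-- A chosen isomorphism `U(h') ≃* U(h)`. -/
def unitaryGroupEquiv (V V' : HermSpace3 L ι₁) :
    unitaryGroup (conjRingHomK L) V'.Hm ≃* unitaryGroup (conjRingHomK L) V.Hm :=
  Classical.choice (nonempty_unitaryGroup_mulEquiv V V')

end HermSpace3

end HodgeCM
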